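import Mathlib
import Summits.Ventures.PercRepro2.TypedClassPendant

/-!
# The typed (PS) count at a pendant split point is twice the typed (PS1) count
(blind cell PercRepro2, night-3 g27, 2026-08-29; `proofs/NIGHT3-CERT.md` §36.11 / §36.14)

Let `w` be a leaf joined to `u` by the typed edge `e`, the other typed edges `S₁` avoiding `w`, and
`F, G` functionals ignoring `w`.  A colouring of `S₁ ∪ {e}` has `e` red or blue: red ⟹ `w` lies in
the red cluster of `s` iff `u` does and never in the blue one; blue ⟹ the mirror.  The global
colour swap exchanges the two halves and fixes the increment product, so

`S_D(S₁ ∪ {e}; s, w; F, G) = 2 · T(S₁; s, u; F, G)`   (`typedCountXOR_pendant_split`),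

`S_D = typedCountW wXOR` the class count «`w` in exactly one cluster» (the Bernstein coefficient of
the cross form (PS)) and `T = typedCount` the (PS1) count.  Hence every negative (PS1) count —
`T(K_{2,5}) = −3` — is a negative (PS) count one vertex up (`TypedPSCountNegative`: `−6`).
Own work; standard axioms.
-/

namespace Summit.Ventures.PercRepro2

namespace TypedDeletion

variable {V : Type*} {E : Type*} [Fintype E] [DecidableEq E]
  {R : Type*} [Field R] [LinearOrder R] [IsStrictOrderedRing R]

open Classical

omit [Fintype E] [DecidableEq E] [Field R] [LinearOrder R] [IsStrictOrderedRing R] in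
/-- `F` ignores the vertex `w` (the typed-count copy of `CovForm.PointSplit.IgnoresVertex`). -/
def IgnoresW (w : V) (F : Set V → R) : Prop := ∀ S, F (S \ {w}) = F S

/-- The indicator configuration of a single edge. -/
def single (e : E) : Config E := fun f => decide (f = e)

omit [Fintype E] in
/-- The configurations supported on `{e}` are the empty one and `single e`. -/
lemma onS_singleEdge_iff (e : E) (ω : Config E) :
    OnS ({e} : Finset E) ω ↔ ω = (fun _ => false) ∨ ω = single e := by
  constructor
  · intro h
    by_cases he : ω e = true
    · right
      funext f
      by_cases hf : f = e
      · subst hf; simp [single, he]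
      · have : ω f = false := by
          rcases Bool.eq_false_or_eq_true (ω f) with h' | h'
          · exact absurd (Finset.mem_singleton.1 (h f h')) hf
          · exact h'
        simp [single, hf, this]
    · left
      funext f
      by_cases hf : f = e
      · subst hf; simpa using he
      · rcases Bool.eq_false_or_eq_true (ω f) with h' | h'
        · exact absurd (Finset.mem_singleton.1 (h f h')) hf
        · exact h'
  · rintro (rfl | rfl)
    · intro f hf; simp at hf
    · intro f hf
      simp only [single, decide_eq_true_eq] at hf
      exact Finset.mem_singleton.2 hf

omit [Fintype E] in
/-- `single e ≠ 0`. -/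
lemma single_ne_zero (e : E) : single e ≠ (fun _ => false) := by
  intro h
  have := congrFun h e
  simp [single] at this

omit [LinearOrder R] [IsStrictOrderedRing R] in
/-- A sum over the configurations supported on `{e}` has two terms. -/
lemma sum_onS_singleEdge (e : E) (g : Config E → R) :
    ∑ ω : Config E, (if OnS ({e} : Finset E) ω then g ω else 0) =
      g (fun _ => false) + g (single e) := by
  rw [← Finset.sum_filter]
  have hfilt : (Finset.univ.filter fun ω : Config E => OnS ({e} : Finset E) ω) =
      {fun _ => false, single e} := by
    ext ω
    simp only [Finset.mem_filter, Finset.mem_univ, true_and, Finset.mem_insert,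
      Finset.mem_singleton]
    exact onS_singleEdge_iff e ω
  rw [hfilt, Finset.sum_pair (single_ne_zero e).symm]

omit [Fintype E] [DecidableEq E] in
/-- `join ω 0 = ω`. -/
lemma join_zero (ω : Config E) : join ω (fun _ => false) = ω := by
  funext f; simp [join_apply]

omit [Fintype E] in
/-- The cluster of `u` under `single e`, `ends e = {u, w}`: `{u, w}`. -/
lemma cluster_single_eq {ends : E → Sym2 V} {e : E} {u w : V} (hends : ends e = s(u, w)) :
    cluster ends (single e) u = {u, w} := by
  ext x
  simp only [mem_cluster, Set.mem_insert_iff, Set.mem_singleton_iff]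
  constructor
  · intro h
    -- closure set `{u, w}`
    have hS : ∀ y ∈ ({u, w} : Set V), ∀ z, (openGraph ends (single e)).Adj y z →
        z ∈ ({u, w} : Set V) := by
      intro y hy z hyz
      rw [openGraph_adj] at hyz
      obtain ⟨-, f, hf, hfe⟩ := hyz
      simp only [single, decide_eq_true_eq] at hf
      subst hf
      rw [hends, Sym2.eq_iff] at hfe
      rcases hfe with ⟨-, hz⟩ | ⟨hz, -⟩
      · rw [← hz]; simp
      · rw [← hz]; simp
    exact mem_of_conn_of_closed hS (by simp) h
  · rintro (rfl | rfl)
    · exact conn_refl _ _ _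
    · exact conn_of_openAdj ⟨e, by simp [single], hends⟩

omit [Fintype E] [DecidableEq E] in
/-- The cluster of `u` under the empty configuration: `{u}`. -/
lemma cluster_zero_eq (ends : E → Sym2 V) (u : V) : cluster ends (fun _ => false) u = {u} := by
  ext x
  simp only [mem_cluster, Set.mem_singleton_iff]
  constructor
  · intro h
    have hS : ∀ y ∈ ({u} : Set V), ∀ z, (openGraph ends (fun _ => false)).Adj y z →
        z ∈ ({u} : Set V) := by
      intro y _ z hyz
      rw [openGraph_adj] at hyz
      obtain ⟨-, f, hf, -⟩ := hyz
      simp at hf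
    exact mem_of_conn_of_closed hS rfl h
  · rintro rfl
    exact conn_refl _ _ _

omit [Fintype E] [DecidableEq E] [LinearOrder R] [IsStrictOrderedRing R] in
/-- `dlt` is symmetric. -/
lemma dlt_comm (F G : Set V → R) (P Q : Set V) : dlt F G P Q = dlt F G Q P := by
  unfold dlt; ring

omit [LinearOrder R] [IsStrictOrderedRing R] in
/-- **The typed pendant split point**: `S_D(S₁ ∪ {e}; s, w) = 2·T(S₁; s, u)` for a leaf `w` at `u`
(edge `e ∉ S₁`, the edges of `S₁` avoiding `w`, `s ≠ w`, `u ≠ w`, `F, G` ignoring `w`). -/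
theorem typedCountXOR_pendant_split (ends : E → Sym2 V) {e : E} {u w : V} (huw : u ≠ w)
    (hends : ends e = s(u, w)) {S₁ : Finset E} (he : e ∉ S₁)
    (h₁ : ∀ f ∈ S₁, ∀ x ∈ ends f, x ≠ w) {s : V} (hs : s ≠ w) {F G : Set V → R}
    (hF : IgnoresW w F) (hG : IgnoresW w G) :
    typedCountW (wXOR : Bool → Bool → R) ends s w F G (S₁ ∪ {e}) ∅ =
      2 * typedCount ends s u F G S₁ ∅ := by
  have hd : Disjoint S₁ ({e} : Finset E) := Finset.disjoint_singleton_right.2 he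
  -- the pendant hypotheses of `cluster_join_pendant` with `V₁ = {x | x ≠ w}`
  have hsV : s ∈ {x : V | x ≠ w} := hs
  have huV : u ∈ {x : V | x ≠ w} := huw
  have h₁' : ∀ f ∈ S₁, ∀ x ∈ ends f, x ∈ {x : V | x ≠ w} := fun f hf x hx => h₁ f hf x hx
  have h₂' : ∀ f ∈ ({e} : Finset E), ∀ x ∈ ends f, x ∉ {x : V | x ≠ w} ∨ x = u := by
    intro f hf x hx
    rw [Finset.mem_singleton] at hf
    subst hf
    rw [hends] at hx
    rcases Sym2.mem_iff.1 hx with rfl | rfl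
    · exact Or.inr rfl
    · exact Or.inl (fun h => h rfl)
  unfold typedCountW typedCount
  simp only [withC_empty]
  rw [sum_onS_union hd]
  -- the inner two-term sums
  have key : ∀ ω₁ : Config E, OnS S₁ ω₁ →
      (∑ ω₂ : Config E, if OnS ({e} : Finset E) ω₂ then
        wtW (wXOR : Bool → Bool → R) ends s w (join ω₁ ω₂) (flipOn (S₁ ∪ {e}) (join ω₁ ω₂)) *
          dlt F G (cluster ends (join ω₁ ω₂) s) (cluster ends (flipOn (S₁ ∪ {e}) (join ω₁ ω₂)) s)
        else 0) =
      (wt ends s u ω₁ + wt ends s u (flipOn S₁ ω₁)) *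
        dlt F G (cluster ends ω₁ s) (cluster ends (flipOn S₁ ω₁) s) := by
    intro ω₁ hω₁
    rw [sum_onS_singleEdge]
    have h0 : OnS ({e} : Finset E) (fun _ => false) := fun f hf => by simp at hf
    have h1 : OnS ({e} : Finset E) (single e) := fun f hf => by
      simp only [single, decide_eq_true_eq] at hf; exact Finset.mem_singleton.2 hf
    have hY₁ : OnS S₁ (flipOn S₁ ω₁) := onS_flipOn S₁ ω₁
    -- the two configurations and their flips
    have hflip0 : flipOn (S₁ ∪ {e}) (join ω₁ (fun _ => false)) = join (flipOn S₁ ω₁) (single e) := by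
      rw [flipOn_union_join hd hω₁ h0]
      congr 1
      funext f
      simp [flipOn_apply, single]
    have hflip1 : flipOn (S₁ ∪ {e}) (join ω₁ (single e)) = join (flipOn S₁ ω₁) (fun _ => false) := by
      rw [flipOn_union_join hd hω₁ h1]
      congr 1
      funext f
      simp [flipOn_apply, single]
    -- clusters
    have hC0 : cluster ends (join ω₁ (fun _ => false)) s = cluster ends ω₁ s := by
      rw [join_zero]
    have hC1 : cluster ends (join ω₁ (single e)) s =
        cluster ends ω₁ s ∪ (if u ∈ cluster ends ω₁ s then {u, w} else ∅) := by
      rw [cluster_join_pendant hsV huV h₁' h₂' hω₁ h1, cluster_single_eq hends]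
    have hB0 : cluster ends (join (flipOn S₁ ω₁) (single e)) s =
        cluster ends (flipOn S₁ ω₁) s ∪ (if u ∈ cluster ends (flipOn S₁ ω₁) s then {u, w} else ∅) := by
      rw [cluster_join_pendant hsV huV h₁' h₂' hY₁ h1, cluster_single_eq hends]
    have hB1 : cluster ends (join (flipOn S₁ ω₁) (fun _ => false)) s = cluster ends (flipOn S₁ ω₁) s := by
      rw [join_zero]
    -- `w` is in no cluster of `S₁`
    have hwC : w ∉ cluster ends ω₁ s :=
      fun h => (cluster_subset_of_edges_in hsV (fun f hf x hx => h₁' f (hω₁ f hf) x hx) h) rfl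
    have hwB : w ∉ cluster ends (flipOn S₁ ω₁) s :=
      fun h => (cluster_subset_of_edges_in hsV (fun f hf x hx => h₁' f (hY₁ f hf) x hx) h) rfl
    -- the functionals ignore the added `w` (and `u` is already there)
    have hFext : ∀ (X : Set V), u ∈ X → F (X ∪ {u, w}) = F X := by
      intro X hu
      rw [← hF (X ∪ {u, w}), ← hF X]
      congr 1
      ext x
      simp only [Set.mem_sdiff, Set.mem_union, Set.mem_insert_iff, Set.mem_singleton_iff]
      constructor
      · rintro ⟨h | h | h, hx⟩
        · exact ⟨h, hx⟩
        · exact ⟨h ▸ hu, hx⟩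
        · exact absurd h hx
      · rintro ⟨h, hx⟩
        exact ⟨Or.inl h, hx⟩
    have hGext : ∀ (X : Set V), u ∈ X → G (X ∪ {u, w}) = G X := by
      intro X hu
      rw [← hG (X ∪ {u, w}), ← hG X]
      congr 1
      ext x
      simp only [Set.mem_sdiff, Set.mem_union, Set.mem_insert_iff, Set.mem_singleton_iff]
      constructor
      · rintro ⟨h | h | h, hx⟩
        · exact ⟨h, hx⟩
        · exact ⟨h ▸ hu, hx⟩
        · exact absurd h hx
      · rintro ⟨h, hx⟩
        exact ⟨Or.inl h, hx⟩
    have hdlt1 : ∀ (X Y : Set V), dlt F G (X ∪ (if u ∈ X then {u, w} else ∅)) Y = dlt F G X Y := by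
      intro X Y
      by_cases hu : u ∈ X
      · rw [if_pos hu]; unfold dlt; rw [hFext X hu, hGext X hu]
      · rw [if_neg hu, Set.union_empty]
    have hdlt2 : ∀ (X Y : Set V), dlt F G X (Y ∪ (if u ∈ Y then {u, w} else ∅)) = dlt F G X Y := by
      intro X Y
      rw [dlt_comm, hdlt1, dlt_comm]
    -- the weights
    unfold wtW wXOR wt
    rw [hflip0, hflip1, hC0, hC1, hB0, hB1, hdlt1, hdlt2]
    have hw0 : w ∉ cluster ends ω₁ s := hwC
    have hw1 : (w ∈ cluster ends (flipOn S₁ ω₁) s ∪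
        (if u ∈ cluster ends (flipOn S₁ ω₁) s then {u, w} else ∅)) ↔ u ∈ cluster ends (flipOn S₁ ω₁) s := by
      constructor
      · intro h
        simp only [Set.mem_union] at h
        rcases h with h | h
        · exact absurd h hwB
        · by_contra hu; rw [if_neg hu] at h; exact h
      · intro hu; rw [if_pos hu]; exact Set.mem_union_right _ (by simp)
    have hw2 : (w ∈ cluster ends ω₁ s ∪ (if u ∈ cluster ends ω₁ s then {u, w} else ∅)) ↔
        u ∈ cluster ends ω₁ s := by
      constructor
      · intro h
        simp only [Set.mem_union] at h
        rcases h with h | h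
        · exact absurd h hwC
        · by_contra hu; rw [if_neg hu] at h; exact h
      · intro hu; rw [if_pos hu]; exact Set.mem_union_right _ (by simp)
    rw [decide_eq_decide.2 hw1, decide_eq_decide.2 hw2, decide_eq_false hw0, decide_eq_false hwB]
    · by_cases hu1 : u ∈ cluster ends ω₁ s <;> by_cases hu2 : u ∈ cluster ends (flipOn S₁ ω₁) s <;>
        simp [hu1, hu2]
      ring
    all_goals exact Classical.propDecidable _
  have hstep : ∀ ω₁ : Config E, (if OnS S₁ ω₁ then ∑ ω₂ : Config E, (if OnS ({e} : Finset E) ω₂ then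
          wtW (wXOR : Bool → Bool → R) ends s w (join ω₁ ω₂) (flipOn (S₁ ∪ {e}) (join ω₁ ω₂)) *
            dlt F G (cluster ends (join ω₁ ω₂) s) (cluster ends (flipOn (S₁ ∪ {e}) (join ω₁ ω₂)) s)
          else 0) else 0) =
        (if OnS S₁ ω₁ then (wt ends s u ω₁ + wt ends s u (flipOn S₁ ω₁)) *
          dlt F G (cluster ends ω₁ s) (cluster ends (flipOn S₁ ω₁) s) else 0) := by
    intro ω₁
    by_cases hω₁ : OnS S₁ ω₁
    · rw [if_pos hω₁, if_pos hω₁, key ω₁ hω₁]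
    · rw [if_neg hω₁, if_neg hω₁]
  rw [Finset.sum_congr rfl fun ω₁ _ => hstep ω₁]
  -- split the sum and flip the second half
  set g : Config E → R := fun ω => wt ends s u ω *
    dlt F G (cluster ends ω s) (cluster ends (flipOn S₁ ω) s) with hg
  have hsplit : ∀ ω₁ : Config E, (if OnS S₁ ω₁ then (wt ends s u ω₁ + wt ends s u (flipOn S₁ ω₁)) *
      dlt F G (cluster ends ω₁ s) (cluster ends (flipOn S₁ ω₁) s) else 0) =
      (if OnS S₁ ω₁ then g ω₁ else 0) + (if OnS S₁ ω₁ then g (flipOn S₁ ω₁) else 0) := by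
    intro ω₁
    by_cases hω₁ : OnS S₁ ω₁
    · simp only [if_pos hω₁, hg, flipOn_flipOn hω₁]
      rw [dlt_comm F G (cluster ends (flipOn S₁ ω₁) s)]
      ring
    · simp [hω₁]
  rw [Finset.sum_congr rfl fun ω₁ _ => hsplit ω₁, Finset.sum_add_distrib, sum_onS_flip S₁ g]
  ring

end TypedDeletion

end Summit.Ventures.PercRepro2
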